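import Literature.Computability.Cryptography.LiuPassLemma53Hiding
import Literature.Computability.Cryptography.LiuPassLemma53Programs
import HarnessLib

/-!
# Liu–Pass Lemma 5.3: the printed inverter `𝒜'` of the hiding claim is polynomial time

Discharge of the named fact `L53Params.hidRun_polyTime` of `LiuPassLemma53Hiding.lean`: for a
PPT `𝒜` and polynomial-time `f`, the run function `L53Params.hidRun` of the inverter `𝒜'` in the
proof of the Claim "`f̂` is `𝒮`-hiding" (Liu–Pass, FOCS 2020, Appendix) is polynomial time on the
pair presentation of (input, coins). As for the reduction of Thm 5.5 (`CondRed.redF`,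
`LiuPassCondRedProgram.lean`), it is a pipeline of existing `FP` bricks around one call of `𝒜`:
unary parsing of `1ⁿ`, the advice `(j, κ)` decoded from the coin count by `modLenFn`/`divModFn`,
the lengths of the construction in unary (`L53Prog.mU`, `LU`, `MU`, `R1U`, `R2U`), `take`/`drop`,
the padding (`CondGen.fitF`) and one affine hash (`AffineProg.hashFn`).

* `hidRunF_boolPair : hidRunF ⟨inp, c⟩ = hidRun 𝒜 q_𝒜 inp c`, `hidRunF_mem_FP`,
  `L53Params.hidRun_polyTime_holds`.

## References

* Y. Liu, R. Pass, *On one-way functions and Kolmogorov complexity*, FOCS 2020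
  (arXiv:2009.11514), Appendix (proof of the Claim in the proof of Lemma 5.3: the PPT `𝒜'`).
* S. Arora, B. Barak, *Computational Complexity: A Modern Approach*, CUP 2009, §1.3, §1.4.1.
-/

namespace Literature.Computability.Cryptography

open _root_.Computability Polynomial Complexity Complexity.Brick Complexity.Plumb Complexity.OracleCompose
  Complexity.HashBricks CondRed AffineStr L53Prog

namespace L53HidProg

variable (Q : L53Params) (A : RandAlg (List Bool) (List Bool)) (qA : Polynomial ℕ)

/-! ### The pipeline on `⟨⟨a, y⟩, c⟩` (`n = |a|`) -/

/-- `1ⁿ`. [folklore] -/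
noncomputable def uH : List Bool → List Bool := onesFn ∘ fstF ∘ fstF
/-- `1^{ℓ_𝒜(n)}`, `ℓ_𝒜(n) = 2n + 2 + (m(n) + L(n))`. [folklore] -/
noncomputable def ellAU : List Bool → List Bool :=
  concatFn ∘ fanoutFn (List.cons true ∘ List.cons true ∘ concatFn ∘ fanoutFn uH uH)
    (concatFn ∘ fanoutFn (mU Q ∘ uH) (LU Q ∘ uH))
/-- `1^{K_b}`, `K_b = q_𝒜(ℓ_𝒜(n)) + 1`. [folklore] -/
noncomputable def kbU : List Bool → List Bool := List.cons true ∘ polyFn qA ∘ ellAU Q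
/-- `1^{Base}`, `Base = (n + 2) K_b`. [folklore] -/
noncomputable def baseU : List Bool → List Bool := umulFn ∘ fanoutFn (List.cons true ∘ List.cons true ∘ uH) (kbU Q qA)
/-- `1^{|c| mod Base}`. [folklore] -/
noncomputable def advU : List Bool → List Bool := modLenFn ∘ fanoutFn (baseU Q qA) sndF
/-- `⟨1ʲ, 1^κ⟩ = divMod (|c| mod Base) K_b`. [folklore] -/
noncomputable def dmU : List Bool → List Bool := divModFn ∘ fanoutFn (kbU Q qA) (advU Q qA)
/-- `1^{L(n)}`. [folklore] -/
noncomputable def LNH : List Bool → List Bool := LU Q ∘ uH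
/-- `1^a`, `a = min j L(n)`. [folklore] -/
noncomputable def aUH : List Bool → List Bool := dropFn ∘ fanoutFn (dropFn ∘ fanoutFn (fstF ∘ dmU Q qA) (LNH Q)) (LNH Q)
/-- `1^b`, `b = L(n) − a`. [folklore] -/
noncomputable def bUH : List Bool → List Bool := dropFn ∘ fanoutFn (aUH Q qA) (LNH Q)
/-- `1^{m(n)}`. [folklore] -/
noncomputable def mNH : List Bool → List Bool := mU Q ∘ uH
/-- `ρ = c ↾ m`. [folklore] -/
noncomputable def rhoH : List Bool → List Bool := takeFn ∘ fanoutFn (mNH Q) sndF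
/-- The guessed hash bits `z = ((c ⇂ m) ↾ n) ↾ a`. [folklore] -/
noncomputable def zH : List Bool → List Bool :=
  takeFn ∘ fanoutFn (aUH Q qA) (takeFn ∘ fanoutFn uH (dropFn ∘ fanoutFn (mNH Q) sndF))
/-- The second key `(ρ ⇂ R₁) ↾ R₂`. [folklore] -/
noncomputable def k2H : List Bool → List Bool := takeFn ∘ fanoutFn (R2U Q ∘ uH) (dropFn ∘ fanoutFn (R1U ∘ uH) (rhoH Q))
/-- `1^{M(n)}`. [folklore] -/
noncomputable def MNH : List Bool → List Bool := MU Q ∘ uH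
/-- `pad n y`. [folklore] -/
noncomputable def padH : List Bool → List Bool := CondGen.fitF (MNH Q) (concatFn ∘ fanoutFn (sndF ∘ fstF) (fun _ => [true]))
/-- `h²_{R₂}(pad n y)`. [folklore] -/
noncomputable def h2H : List Bool → List Bool := AffineProg.hashFn ∘ fanoutFn (fanoutFn (MNH Q) (bUH Q qA)) (fanoutFn (k2H Q) (padH Q))
/-- The query `⟨1ⁿ, ρ ‖ z ‖ h²⟩`. [folklore] -/
noncomputable def queryH : List Bool → List Bool :=
  fanoutFn uH (concatFn ∘ fanoutFn (concatFn ∘ fanoutFn (rhoH Q) (zH Q qA)) (h2H Q qA))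
/-- `𝒜`'s coins `(c ⇂ (m + n)) ↾ κ`. [folklore] -/
noncomputable def coinsH : List Bool → List Bool :=
  takeFn ∘ fanoutFn (sndF ∘ dmU Q qA) (dropFn ∘ fanoutFn (concatFn ∘ fanoutFn (mNH Q) uH) sndF)
/-- `𝒜` as a string function `⟨x, r⟩ ↦ 𝒜(x; r)`. [folklore] -/
def aStr : List Bool → List Bool := (fun p : List Bool × List Bool => A.run p.1 p.2) ∘ boolUnpair
/-- **The run function of `𝒜'` as a string function on `⟨inp, coins⟩`.** [folklore] -/
noncomputable def hidRunF : List Bool → List Bool := aStr A ∘ fanoutFn (queryH Q qA) (coinsH Q qA)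

variable {Q A qA}

/-- Value of `uH`. [folklore] -/
theorem uH_apply (z : List Bool) : uH z = ones (boolUnpair (boolUnpair z).1).1.length := by
  simp only [uH, Function.comp_apply, onesFn_eq_ones, fstF]

/-- Value of `ellAU`. [folklore] -/
theorem ellAU_apply (z : List Bool) : ellAU Q z = ones (Q.ℓA (boolUnpair (boolUnpair z).1).1.length) := by
  simp only [ellAU, Function.comp_apply, fanoutFn_apply, uH_apply, concatFn_boolPair, Com.ones_append, true_cons_ones,
    mU_apply, LU_apply, List.length_replicate, L53Params.ℓA]
  congr 1
  omega

/-- Value of `kbU`. [folklore] -/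
theorem kbU_apply (z : List Bool) : kbU Q qA z = ones (Q.KbH qA (boolUnpair (boolUnpair z).1).1.length) := by
  simp only [kbU, Function.comp_apply, ellAU_apply, polyFn_apply, List.length_replicate, true_cons_ones, L53Params.KbH]

/-- Value of `dmU`: the decoded advice. [folklore] -/
theorem dmU_apply (z : List Bool) :
    dmU Q qA z = boolPair
      (ones ((boolUnpair z).2.length % Q.BaseH qA (boolUnpair (boolUnpair z).1).1.length / Q.KbH qA (boolUnpair (boolUnpair z).1).1.length))
      (ones ((boolUnpair z).2.length % Q.BaseH qA (boolUnpair (boolUnpair z).1).1.length % Q.KbH qA (boolUnpair (boolUnpair z).1).1.length)) := by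
  simp only [dmU, advU, baseU, Function.comp_apply, fanoutFn_apply, kbU_apply, uH_apply, true_cons_ones, umulFn_boolPair,
    modLenFn_boolPair, divModFn_boolPair, sndF, L53Params.BaseH]

/-- **The pipeline computes the run function of `𝒜'`.** [Y. Liu, R. Pass, FOCS 2020, Appendix
(the PPT `𝒜'`)] [folklore] -/
theorem hidRunF_boolPair (inp c : List Bool) : hidRunF Q A qA (boolPair inp c) = Q.hidRun A qA inp c := by
  have ha : ∀ j : ℕ, Q.L (boolUnpair inp).1.length - (Q.L (boolUnpair inp).1.length - j) = Q.aOf j (boolUnpair inp).1.length :=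
    fun j => sub_sub_eq_min _ _
  simp only [hidRunF, aStr, queryH, coinsH, h2H, padH, MNH, k2H, zH, rhoH, mNH, bUH, aUH, LNH, Function.comp_apply,
    fanoutFn_apply, dmU_apply, uH_apply, boolUnpair_boolPair, mU_apply, LU_apply, MU_apply,
    R1U_apply, R2U_apply, List.length_replicate, takeFn_boolPair, dropFn_boolPair, concatFn_boolPair, Com.drop_ones,
    Com.ones_append, AffineProg.hashFn_boolPair, CondGen.fitF_apply, fstF, sndF, ha, L53Params.hidRun, L53Params.bOf,
    L53Params.pad, unaryEncodeNat_eq_ones, List.append_assoc]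

/-- `hidRunF ∈ FP` for `𝒜` polynomial time (as a string function) and `f ∈ FP`. [folklore] -/
theorem hidRunF_mem_FP (hA : aStr A ∈ FP) : hidRunF Q A qA ∈ FP := by
  have hu : uH ∈ FP := comp_mem_FP onesFn_mem_FP (comp_mem_FP fstF_mem_FP fstF_mem_FP)
  have hell : ellAU Q ∈ FP :=
    comp_mem_FP concatFn_mem_FP (fanoutFn_mem_FP
      (comp_mem_FP (cons_mem_FP true) (comp_mem_FP (cons_mem_FP true) (comp_mem_FP concatFn_mem_FP (fanoutFn_mem_FP hu hu))))
      (comp_mem_FP concatFn_mem_FP (fanoutFn_mem_FP (comp_mem_FP mU_mem_FP hu) (comp_mem_FP LU_mem_FP hu))))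
  have hkb : kbU Q qA ∈ FP := comp_mem_FP (cons_mem_FP true) (comp_mem_FP (polyFn_mem_FP _) hell)
  have hbase : baseU Q qA ∈ FP :=
    comp_mem_FP umulFn_mem_FP (fanoutFn_mem_FP (comp_mem_FP (cons_mem_FP true) (comp_mem_FP (cons_mem_FP true) hu)) hkb)
  have hadv : advU Q qA ∈ FP := comp_mem_FP modLenFn_mem_FP (fanoutFn_mem_FP hbase sndF_mem_FP)
  have hdm : dmU Q qA ∈ FP := comp_mem_FP divModFn_mem_FP (fanoutFn_mem_FP hkb hadv)
  have hLN : LNH Q ∈ FP := comp_mem_FP LU_mem_FP hu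
  have ha : aUH Q qA ∈ FP :=
    comp_mem_FP dropFn_mem_FP (fanoutFn_mem_FP (comp_mem_FP dropFn_mem_FP (fanoutFn_mem_FP (comp_mem_FP fstF_mem_FP hdm) hLN)) hLN)
  have hb : bUH Q qA ∈ FP := comp_mem_FP dropFn_mem_FP (fanoutFn_mem_FP ha hLN)
  have hm : mNH Q ∈ FP := comp_mem_FP mU_mem_FP hu
  have hrho : rhoH Q ∈ FP := comp_mem_FP takeFn_mem_FP (fanoutFn_mem_FP hm sndF_mem_FP)
  have hz : zH Q qA ∈ FP := comp_mem_FP takeFn_mem_FP (fanoutFn_mem_FP ha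
    (comp_mem_FP takeFn_mem_FP (fanoutFn_mem_FP hu (comp_mem_FP dropFn_mem_FP (fanoutFn_mem_FP hm sndF_mem_FP)))))
  have hk2 : k2H Q ∈ FP := comp_mem_FP takeFn_mem_FP (fanoutFn_mem_FP (comp_mem_FP R2U_mem_FP hu)
    (comp_mem_FP dropFn_mem_FP (fanoutFn_mem_FP (comp_mem_FP R1U_mem_FP hu) hrho)))
  have hM : MNH Q ∈ FP := comp_mem_FP MU_mem_FP hu
  have hpad : padH Q ∈ FP :=
    CondGen.fitF_mem_FP hM (comp_mem_FP concatFn_mem_FP (fanoutFn_mem_FP (comp_mem_FP sndF_mem_FP fstF_mem_FP) (const_mem_FP _)))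
  have hh2 : h2H Q qA ∈ FP :=
    comp_mem_FP AffineProg.hashFn_mem_FP (fanoutFn_mem_FP (fanoutFn_mem_FP hM hb) (fanoutFn_mem_FP hk2 hpad))
  have hq : queryH Q qA ∈ FP :=
    fanoutFn_mem_FP hu (comp_mem_FP concatFn_mem_FP (fanoutFn_mem_FP (comp_mem_FP concatFn_mem_FP (fanoutFn_mem_FP hrho hz)) hh2))
  have hc : coinsH Q qA ∈ FP := comp_mem_FP takeFn_mem_FP (fanoutFn_mem_FP (comp_mem_FP sndF_mem_FP hdm)
    (comp_mem_FP dropFn_mem_FP (fanoutFn_mem_FP (comp_mem_FP concatFn_mem_FP (fanoutFn_mem_FP hm hu)) sndF_mem_FP)))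
  exact comp_mem_FP hA (fanoutFn_mem_FP hq hc)

end L53HidProg

/-- **Discharge of `L53Params.hidRun_polyTime`**: for every PPT `𝒜` (and any `f`), the run function
of the printed inverter `𝒜'` is polynomial time on the pair presentation of (input, coins).
[Y. Liu, R. Pass, FOCS 2020, Appendix (proof of the Claim: "Consider the PPT `𝒜'` …")]
[cite: LiuPassFOCS2020, Lemma 5.3 (proof, Appendix: Claim, the PPT A')] -/
theorem L53Params.hidRun_polyTime_holds : L53Params.hidRun_polyTime := by
  intro Q A qA hA _
  have h1 : PolyTimeComputable (fun p : List Bool × List Bool => boolPair p.1 p.2) id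
      (fun p : List Bool × List Bool => A.run p.1 p.2) := by
    obtain ⟨p, M, hM⟩ := hA.1
    exact ⟨p, M, fun a => hM a⟩
  have ha : L53HidProg.aStr A ∈ FP := PolyTimeComputable.comp_holds h1 polyTimeComputable_boolUnpair
  obtain ⟨p, M, hM⟩ := L53HidProg.hidRunF_mem_FP (Q := Q) (qA := qA) ha
  refine ⟨p, M, fun q => ?_⟩
  have hrun := hM (boolPair q.1 q.2)
  simp only [id_eq] at hrun
  rw [L53HidProg.hidRunF_boolPair] at hrun
  exact hrun

end Literature.Computability.Cryptography
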